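import Summits.Ventures.HodgeRepro2.T5SU11ReductionOfOrderAsymptotic
import Summits.Ventures.HodgeRepro2.T5SU11SphericalDecay
import Summits.Ventures.HodgeRepro2.T5SU11JacobiLegendreLeading

/-!
# The exact decay rate of the decaying spherical solution: `e^{λt} χ_λ(t) → 1/((λ − 1) c(2 − λ))` for `λ > 1`

Row 448 built, for `λ > 1`, the decaying solution `χ_λ = φ_λ(a_·) · T_λ` of the radial equation, `T_λ(t) =
∫_t^∞ ds/(sinh 2s φ_λ(a_s)²)`. Its exact rate follows from row 449's Tauberian squeeze: with `c = c(2 − λ) > 0`,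
`e^{2t}/sinh 2t → 2` (`tendsto_exp_div_sinh`) and `e^{(2−λ)t} φ_λ(a_t) → c` (row 334) give

  **`e^{2(λ−1)t} / (sinh 2t · φ_λ(a_t)²) → 2/c²`**  (`tendsto_exp_mul_roIntegrand_sph`),  hence
  **`e^{2(λ−1)t} T_λ(t) → 1/((λ − 1) c²)`**  (`tendsto_exp_mul_tailIntegral_sph`)  and
  **`e^{λt} χ_λ(t) → 1/((λ − 1) c)`**  (`tendsto_exp_mul_sphDecay`):

`χ_λ` decays EXACTLY like `e^{−λt}/((λ − 1) c(2 − λ))`, against the growth `c(2 − λ) e^{(λ−2)t}` of `φ_λ` — the two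
exponents `λ − 2 = λ − 2ρ` and `−λ` of the Harish-Chandra expansion, `2ρ = 2`. At `λ = 2n + 2`, with
`Q_n(cosh 2t) = 2 χ_{2n+2}(t)` (row 448) and `c(−2n) = lc_n/2ⁿ` (row 372), this reproduces row 441's rate
**`e^{(2n+2)t} Q_n(cosh 2t) → 2^{n+1}/((2n+1) lc_n)`** from the general theory (`tendsto_exp_mul_sphQ'`,
`sphQ_limit_consistency`). Nothing is claimed about (N).

Blind lane: Mathlib + the HodgeRepro2 prefix only; no sorry; axioms ⊆ {propext, Classical.choice,
Quot.sound}.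
-/

namespace Summit.Ventures.HodgeRepro2.T5SU11SphericalDecayAsymptotic

open Filter Topology MeasureTheory
open Set (Ioi)
open T5SU11Cartan T5SU11SphericalFunction T5SU11SphericalBounds T5SU11SphericalAsymptotic T5SU11SphericalCfun
  T5SU11ReductionOfOrder T5SU11ReductionOfOrderInfinity T5SU11ReductionOfOrderAsymptotic
  T5SU11SphericalSolutionSpaceAll T5SU11SphericalSecondKind T5SU11SphericalDecay T5SU11JacobiLegendreLeading

/-! ### `e^{2t}/sinh 2t → 2` -/

/-- **`e^{2t}/sinh 2t → 2` as `t → ∞`.** -/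
theorem tendsto_exp_div_sinh : Tendsto (fun t : ℝ => Real.exp (2 * t) / Real.sinh (2 * t)) atTop (𝓝 2) := by
  have h1 : Tendsto (fun t : ℝ => Real.exp (-(4 * t))) atTop (𝓝 0) := by
    have := Real.tendsto_exp_atBot.comp (tendsto_id.const_mul_atTop_of_neg (by norm_num : (-4 : ℝ) < 0))
    simpa only [Function.comp_def, neg_mul, id] using this
  have h2 : Tendsto (fun t : ℝ => 2 / (1 - Real.exp (-(4 * t)))) atTop (𝓝 (2 / (1 - 0))) :=
    tendsto_const_nhds.div (tendsto_const_nhds.sub h1) (by norm_num)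
  rw [sub_zero, div_one] at h2
  refine h2.congr' ?_
  filter_upwards [eventually_gt_atTop 0] with t ht
  have hS : Real.sinh (2 * t) ≠ 0 := (sinh_two_mul_pos ht).ne'
  have hE : Real.exp (-(4 * t)) ≠ 1 := by
    rw [Ne, Real.exp_eq_one_iff]
    linarith
  have h1' : 1 - Real.exp (-(4 * t)) ≠ 0 := sub_ne_zero.mpr (Ne.symm hE)
  have key : Real.exp (2 * t) * Real.exp (-(4 * t)) = Real.exp (-(2 * t)) := by
    rw [← Real.exp_add]
    congr 1
    ring
  rw [div_eq_div_iff h1' hS, Real.sinh_eq]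
  linear_combination key

section measure

variable [MeasurableSpace Circle] [BorelSpace Circle]

/-! ### The rate of the integrand, the tail and the decaying solution -/

/-- **`e^{2(λ−1)t} / (sinh 2t · φ_λ(a_t)²) → 2/c(2 − λ)²`** for `λ > 1`. -/
theorem tendsto_exp_mul_roIntegrand_sph {lam : ℝ} (hlam : 1 < lam) :
    Tendsto (fun t => Real.exp (2 * (lam - 1) * t) * roIntegrand (fun t => sph lam (hyp t)) t) atTop
      (𝓝 (2 / cfun (2 - lam) ^ 2)) := by
  have hc : 0 < cfun (2 - lam) := cfun_pos (by linarith)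
  have h := tendsto_exp_div_sinh.mul (((tendsto_exp_two_sub_mul_sph_hyp hlam).inv₀ hc.ne').pow 2)
  rw [show (2 : ℝ) * (cfun (2 - lam))⁻¹ ^ 2 = 2 / cfun (2 - lam) ^ 2 by rw [inv_pow, div_eq_mul_inv]] at h
  refine h.congr' ?_
  filter_upwards [eventually_gt_atTop 0] with t ht
  have hS : Real.sinh (2 * t) ≠ 0 := (sinh_two_mul_pos ht).ne'
  have hφ : sph lam (hyp t) ≠ 0 := (sph_hyp_pos lam t).ne'
  have hE : Real.exp ((2 - lam) * t) ≠ 0 := (Real.exp_pos _).ne'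
  have key : Real.exp ((2 - lam) * t) ^ 2 * Real.exp (2 * (lam - 1) * t) = Real.exp (2 * t) := by
    rw [← Real.exp_nat_mul, ← Real.exp_add]
    congr 1
    push_cast
    ring
  show Real.exp (2 * t) / Real.sinh (2 * t) * ((Real.exp ((2 - lam) * t) * sph lam (hyp t))⁻¹) ^ 2
    = Real.exp (2 * (lam - 1) * t) * (1 / (Real.sinh (2 * t) * sph lam (hyp t) ^ 2))
  rw [← key]
  field_simp

/-- **`e^{2(λ−1)t} T_λ(t) → 1/((λ − 1) c(2 − λ)²)`** for the tail integral, `λ > 1`. -/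
theorem tendsto_exp_mul_tailIntegral_sph {lam : ℝ} (hlam : 1 < lam) :
    Tendsto (fun t => Real.exp (2 * (lam - 1) * t) * tailIntegral (fun t => sph lam (hyp t)) t) atTop
      (𝓝 (1 / ((lam - 1) * cfun (2 - lam) ^ 2))) := by
  have hc : 0 < cfun (2 - lam) := cfun_pos (by linarith)
  have h := tendsto_exp_mul_tailIntegral (integrableOn_roIntegrand_sph hlam) (by linarith : 0 < 2 * (lam - 1))
    (tendsto_exp_mul_roIntegrand_sph hlam)
  have e : 2 / cfun (2 - lam) ^ 2 / (2 * (lam - 1)) = 1 / ((lam - 1) * cfun (2 - lam) ^ 2) := by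
    have : lam - 1 ≠ 0 := by linarith
    field_simp
  rwa [e] at h

/-- **THE EXACT DECAY RATE: `e^{λt} χ_λ(t) → 1/((λ − 1) c(2 − λ))`** for `λ > 1`. -/
theorem tendsto_exp_mul_sphDecay {lam : ℝ} (hlam : 1 < lam) :
    Tendsto (fun t => Real.exp (lam * t) * sphDecay lam t) atTop (𝓝 (1 / ((lam - 1) * cfun (2 - lam)))) := by
  have hc : 0 < cfun (2 - lam) := cfun_pos (by linarith)
  have h := (tendsto_exp_two_sub_mul_sph_hyp hlam).mul (tendsto_exp_mul_tailIntegral_sph hlam)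
  have e : cfun (2 - lam) * (1 / ((lam - 1) * cfun (2 - lam) ^ 2)) = 1 / ((lam - 1) * cfun (2 - lam)) := by
    have : lam - 1 ≠ 0 := by linarith
    field_simp
  rw [e] at h
  refine h.congr' ?_
  filter_upwards [eventually_gt_atTop 0] with t _
  unfold sphDecay decaySolution
  have key : Real.exp ((2 - lam) * t) * Real.exp (2 * (lam - 1) * t) = Real.exp (lam * t) := by
    rw [← Real.exp_add]
    congr 1
    ring
  rw [← key]
  ring

omit [MeasurableSpace Circle] [BorelSpace Circle] in
/-- `e^{λt} χ_λ(t)` has a positive limit: `χ_λ(t) ≍ e^{−λt}`. -/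
theorem sphDecay_limit_pos {lam : ℝ} (hlam : 1 < lam) : 0 < 1 / ((lam - 1) * cfun (2 - lam)) := by
  have hc : 0 < cfun (2 - lam) := cfun_pos (by linarith)
  have : 0 < lam - 1 := by linarith
  positivity

/-! ### `λ = 2n + 2`: the rate of `Q_n(cosh 2t)` from the general theory -/

/-- `e^{(2n+2)t} Q_n(cosh 2t) → 2/((2n + 1) c(−2n))`, from `Q_n(cosh 2t) = 2 χ_{2n+2}(t)` and the general rate. -/
theorem tendsto_exp_mul_sphQ' (n : ℕ) :
    Tendsto (fun t => Real.exp ((2 * (n : ℝ) + 2) * t) * sphQ n t) atTop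
      (𝓝 (2 / ((2 * (n : ℝ) + 1) * cfun (-(2 * (n : ℝ)))))) := by
  have hlam : (1 : ℝ) < 2 * (n : ℝ) + 2 := by linarith [(Nat.cast_nonneg n : (0 : ℝ) ≤ n)]
  have h := (tendsto_exp_mul_sphDecay hlam).const_mul 2
  have e : (2 : ℝ) * (1 / ((2 * (n : ℝ) + 2 - 1) * cfun (2 - (2 * (n : ℝ) + 2))))
      = 2 / ((2 * (n : ℝ) + 1) * cfun (-(2 * (n : ℝ)))) := by
    rw [show (2 : ℝ) - (2 * (n : ℝ) + 2) = -(2 * (n : ℝ)) by ring, show (2 : ℝ) * (n : ℝ) + 2 - 1 = 2 * n + 1 by ring]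
    ring
  rw [e] at h
  refine h.congr' ?_
  filter_upwards [eventually_gt_atTop 0] with t ht
  rw [sphQ_eq_two_mul_sphDecay n ht]
  ring

omit [MeasurableSpace Circle] [BorelSpace Circle] in
/-- **Consistency with row 441**: `2/((2n + 1) c(−2n)) = 2^{n+1}/((2n + 1) lc_n)`, by `c(−2n) = lc_n/2ⁿ` (row 372);
the general decay rate reproduces the rate computed from Neumann's integral. -/
theorem sphQ_limit_consistency (n : ℕ) :
    2 / ((2 * (n : ℝ) + 1) * cfun (-(2 * (n : ℝ)))) = 2 ^ (n + 1) / ((2 * (n : ℝ) + 1) * legLead n) := by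
  rw [cfun_neg_two_mul_eq_legLead_div]
  have h1 : (2 * (n : ℝ) + 1) ≠ 0 := by positivity
  have h2 : legLead n ≠ 0 := legLead_pos n |>.ne'
  field_simp
  ring

end measure

end Summit.Ventures.HodgeRepro2.T5SU11SphericalDecayAsymptotic
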